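import Summits.SmoothPoincare4.SmoothPoincare4.Theorems.CylinderEntropyCylinderRungTwoLimitMeasureExists
import Literature.Geometry.Riemannian.SphericalCylinderKernelCertificate
import Literature.MeasureTheory.Hausdorff.SmoothImageHausdorffFinite
import HarnessLib

/-!
# Route `CylinderEntropy`, crux `CylinderRungTwo` (stmt-SmoothPoincare4-7631), line `killing-flux`:
# weak convergence of the area measures gives convergence of the typed kernel integrals with
# moving centres (registered helper `helper_kernelIntegralTendstoOfWeakLimit`, step K2 of the
# "relaxation up to multiplicity" programme of lead c4)

Let `ι k : M⁴ → N = S⁴ × ℝ = {z ∈ ℝ⁶ | ∑_{i<5} zᵢ² = 1}` be smooth embeddings of a compact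
`4`-manifold, confined to the slab `|z₅| ≤ B`, whose area measures `μH⁴ ⌊ range (ι k)` converge
weakly (against bounded continuous test functions on `ℝ⁶`) to a finite Borel measure `μ` carried by
the compact set `C = {∑_{i<5} zᵢ² = 1, |z₅| ≤ B}`.  Then for centres `y k ∈ N` converging to `y₀` and a
FIXED scale `τ > 0` the typed cylinder-kernel integrals converge:

  `∫_{range (ι k)} K_{y k, τ} dμH⁴ ⟶ ∫ K_{y₀, τ} dμ`     (`K_{p,τ} = cylKernel p τ`).

Proof (elementary).  (1) The kernel `(p, z) ↦ K_{p,τ}(z) = 𝔥(τ, ⟨z', p'⟩) e^{-(z₅-p₅)²/4τ}` is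
jointly continuous on `ℝ⁶ × ℝ⁶` (`continuous_cylKernel_uncurry`, from the continuity of the zonal
series `𝔥(τ, ·)` on `ℝ`), hence transversely uniformly continuous along the compact fibre `C`
(`IsCompact.mem_uniformity_of_prod`): `K_{y k,τ} → K_{y₀,τ}` UNIFORMLY on `C ⊇ range (ι k)`; the
areas `μH⁴(range (ι k))` are finite (`C¹` image of a compact manifold) and converge (test `g ≡ 1`),
so `|∫_{range (ι k)} (K_{y k,τ} - K_{y₀,τ}) dμH⁴| ≤ sup_C |K_{y k,τ} - K_{y₀,τ}| · μH⁴(range (ι k)) → 0`.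
(2) `K_{y₀,τ}` is continuous but unbounded on `ℝ⁶`; clamping it to `[-L, L]` with
`L ≥ sup_C |K_{y₀,τ}|` gives a bounded continuous `g` that agrees with `K_{y₀,τ}` on `C`, hence on
every `range (ι k)` and `μ`-almost everywhere (`μ Cᶜ = 0`), so the weak convergence applied to `g`
reads `∫_{range (ι k)} K_{y₀,τ} dμH⁴ → ∫ K_{y₀,τ} dμ`.  (1) + (2) give the claim.

Everything here is PROVED (no `sorry`, no definitions, no named facts).

References: P. Billingsley, *Convergence of probability measures*, 2nd ed. (1999), §2 (weak
convergence against bounded continuous functions); R. S. Hamilton, *Monotonicity formulas for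
parabolic flows on manifolds*, Comm. Anal. Geom. 1 (1993), 127–137 (the kernel).
-/

-- the prescribed namespace `Summit.SmoothPoincare4.SmoothPoincare4.…` repeats `SmoothPoincare4`
set_option linter.dupNamespace false

noncomputable section

open Bundle Set Function Filter MeasureTheory Module
open scoped Manifold ContDiff Topology RealInnerProductSpace BigOperators ENNReal NNReal

namespace Summit.SmoothPoincare4.SmoothPoincare4.Cruxes.CylinderRungTwo.KillingFlux

open Literature.Geometry.Riemannian Literature.Geometry.Riemannian.SphericalCylinderConformal
open Literature.Geometry.Riemannian.SphericalCylinderEntropy (cylKernel zonal cylKernel_eq)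

section KernelContinuity

/-- **Joint continuity of the typed cylinder kernel**: for `τ > 0` the map
`(p, z) ↦ K_{p,τ}(z) = 𝔥(τ, ⟨z', p'⟩) · e^{-(z₅-p₅)²/4τ}` is continuous on `ℝ⁶ × ℝ⁶` (the zonal
series `𝔥(τ, ·)` is continuous on `ℝ`). [folklore] -/
theorem continuous_cylKernel_uncurry {τ : ℝ} (hτ : 0 < τ) :
    Continuous fun q : EuclideanSpace ℝ (Fin 6) × EuclideanSpace ℝ (Fin 6) => cylKernel q.1 τ q.2 := by
  have h : (fun q : EuclideanSpace ℝ (Fin 6) × EuclideanSpace ℝ (Fin 6) => cylKernel q.1 τ q.2) =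
      fun q => zonal τ (∑ i : Fin 5, q.2 (Fin.castSucc i) * q.1 (Fin.castSucc i)) *
        Real.exp (-((q.2 5 - q.1 5) ^ 2) / (4 * τ)) :=
    funext fun q => cylKernel_eq q.1 τ q.2
  rw [h]
  have hc : Continuous fun q : EuclideanSpace ℝ (Fin 6) × EuclideanSpace ℝ (Fin 6) =>
      ∑ i : Fin 5, q.2 (Fin.castSucc i) * q.1 (Fin.castSucc i) := by
    fun_prop
  have he : Continuous fun q : EuclideanSpace ℝ (Fin 6) × EuclideanSpace ℝ (Fin 6) =>
      Real.exp (-((q.2 5 - q.1 5) ^ 2) / (4 * τ)) := by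
    fun_prop
  exact ((SphericalZonalKernelSeries.continuous_zonal hτ).comp hc).mul he

/-- **The typed kernels with moving centres converge uniformly on compact sets**: if `y k → y₀` in
`ℝ⁶`, `τ > 0` and `C ⊆ ℝ⁶` is compact, then for every `ε > 0`, eventually
`|K_{y k,τ}(z) - K_{y₀,τ}(z)| < ε` for all `z ∈ C` (transverse uniform continuity of a jointly
continuous kernel along a compact fibre). [folklore] -/
theorem eventually_abs_cylKernel_sub_lt {C : Set (EuclideanSpace ℝ (Fin 6))} (hC : IsCompact C)
    {y : ℕ → EuclideanSpace ℝ (Fin 6)} {y₀ : EuclideanSpace ℝ (Fin 6)}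
    (hy : Tendsto y atTop (𝓝 y₀)) {τ : ℝ} (hτ : 0 < τ) {ε : ℝ} (hε : 0 < ε) :
    ∀ᶠ k in atTop, ∀ z ∈ C, |cylKernel (y k) τ z - cylKernel y₀ τ z| < ε := by
  obtain ⟨v, hv, hvC⟩ := hC.mem_uniformity_of_prod
    (f := fun (p : EuclideanSpace ℝ (Fin 6)) (z : EuclideanSpace ℝ (Fin 6)) => cylKernel p τ z)
    (s := univ) (continuous_cylKernel_uncurry hτ).continuousOn (mem_univ y₀)
    (Metric.dist_mem_uniformity hε)
  rw [nhdsWithin_univ] at hv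
  filter_upwards [hy.eventually_mem hv] with k hk z hz
  have h : dist (cylKernel (y k) τ z) (cylKernel y₀ τ z) < ε := hvC (y k) hk z hz
  rwa [Real.dist_eq] at h

/-- The slab part `C = {∑_{i<5} zᵢ² = 1, |z₅| ≤ B}` of the round cylinder `N ⊂ ℝ⁶` is compact
(closed, and bounded by `‖z‖ ≤ 1 + |B|`). [folklore] -/
theorem isCompact_cylinderSlab (B : ℝ) :
    IsCompact {z : EuclideanSpace ℝ (Fin 6) | ∑ i : Fin 5, z (Fin.castSucc i) ^ 2 = 1 ∧ |z 5| ≤ B} := by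
  have hKc : IsClosed {z : EuclideanSpace ℝ (Fin 6) |
      ∑ i : Fin 5, z (Fin.castSucc i) ^ 2 = 1 ∧ |z 5| ≤ B} := by
    rw [Set.setOf_and]
    exact (isClosed_eq (by fun_prop) continuous_const).inter
      (isClosed_le (by fun_prop) continuous_const)
  have hKb : Bornology.IsBounded {z : EuclideanSpace ℝ (Fin 6) |
      ∑ i : Fin 5, z (Fin.castSucc i) ^ 2 = 1 ∧ |z 5| ≤ B} := by
    rw [isBounded_iff_forall_norm_le]
    refine ⟨1 + |B|, fun z hz => ?_⟩
    have hsq : ‖z‖ ^ 2 = ∑ i : Fin 5, z (Fin.castSucc i) ^ 2 + z 5 ^ 2 := by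
      rw [EuclideanSpace.real_norm_sq_eq, Fin.sum_univ_castSucc]
      rfl
    have hz5 : |z 5| ≤ |B| := hz.2.trans (le_abs_self B)
    have h5 : z 5 ^ 2 ≤ |B| ^ 2 := by
      rw [← sq_abs (z 5)]
      exact pow_le_pow_left₀ (abs_nonneg _) hz5 2
    refine le_of_pow_le_pow_left₀ two_ne_zero (by positivity) ?_
    rw [hsq, hz.1]
    nlinarith [abs_nonneg B]
  exact Metric.isCompact_of_isClosed_isBounded hKc hKb

end KernelContinuity

/-- **Weak convergence of the area measures gives convergence of the typed kernel integrals with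
moving centres** (registered helper `helper_kernelIntegralTendstoOfWeakLimit`, step K2 of the
relaxation programme of line `killing-flux`).  For smooth embeddings `ι k : M → ℝ⁶` of a compact
`4`-manifold into `N = {∑_{i<5} zᵢ² = 1}` with heights `|(ι k x)₅| ≤ B`, a finite measure `μ` carried
by `{∑_{i<5} zᵢ² = 1, |z₅| ≤ B}` with `∫_{range (ι k)} g dμH⁴ → ∫ g dμ` for every bounded continuous
`g`, centres `y k ∈ N` with `y k → y₀`, and `τ > 0`:
`∫_{range (ι k)} K_{y k,τ} dμH⁴ → ∫ K_{y₀,τ} dμ` (uniform convergence `K_{y k,τ} → K_{y₀,τ}` on the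
compact carrier, finiteness and convergence of the areas, and the weak convergence tested against
the clamped kernel `max (-L) (min L K_{y₀,τ})`). [folklore] -/
theorem helper_kernelIntegralTendstoOfWeakLimit : ∀ (M : Type) [TopologicalSpace M] [T2Space M] [SecondCountableTopology M] [ChartedSpace (EuclideanSpace ℝ (Fin 4)) M] [IsManifold (𝓡 4) ∞ M] [CompactSpace M] (ι : ℕ → M → EuclideanSpace ℝ (Fin 6)), (∀ k, Manifold.IsSmoothEmbedding (𝓡 4) (𝓡 6) ∞ (ι k)) → (∀ k x, ∑ i : Fin 5, ι k x (Fin.castSucc i) ^ 2 = 1) → ∀ B : ℝ, (∀ k x, |ι k x 5| ≤ B) → ∀ (μ : Measure (EuclideanSpace ℝ (Fin 6))) [IsFiniteMeasure μ], μ {z : EuclideanSpace ℝ (Fin 6) | ¬ (∑ i : Fin 5, z (Fin.castSucc i) ^ 2 = 1 ∧ |z 5| ≤ B)} = 0 → (∀ g : BoundedContinuousFunction (EuclideanSpace ℝ (Fin 6)) ℝ, Filter.Tendsto (fun k => ∫ z in Set.range (ι k), g z ∂(μH[4] : Measure (EuclideanSpace ℝ (Fin 6)))) Filter.atTop (𝓝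 (∫ z, g z ∂μ))) → ∀ (y : ℕ → EuclideanSpace ℝ (Fin 6)) (y₀ : EuclideanSpace ℝ (Fin 6)), (∀ k, ∑ i : Fin 5, y k (Fin.castSucc i) ^ 2 = 1) → Filter.Tendsto y Filter.atTop (𝓝 y₀) → ∀ τ : ℝ, 0 < τ → Filter.Tendsto (fun k => ∫ z in Set.range (ι k), Literature.Geometry.Riemannian.SphericalCylinderEntropy.cylKernel (y k) τ z ∂(μH[4] : Measure (EuclideanSpace ℝ (Fin 6)))) Filter.atTop (𝓝 (∫ z, Literature.Geometry.Riemannian.SphericalCylinderEntropy.cylKernel y₀ τ z ∂μ)) := by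
  intro M _ _ _ _ _ _ ι hemb hN B hB μ _ hμC hweak y y₀ _hyN hy τ hτ
  -- Step 0: the areas are finite and the images measurable
  have hcont : ∀ k, Continuous (ι k) := fun k => (hemb k).isEmbedding.continuous
  have hfin : ∀ k, μH[4] (Set.range (ι k)) < ⊤ := fun k =>
    Literature.MeasureTheory.Hausdorff.hausdorffMeasure_range_lt_top (E := EuclideanSpace ℝ (Fin 4))
      (I := 𝓡 4) (hemb k).contMDiff (by simp) (d := 4) (by simp)
  have hmeas : ∀ k, MeasurableSet (Set.range (ι k)) := fun k =>
    (isCompact_range (hcont k)).isClosed.measurableSet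
  -- Step 1: the compact carrier `C`
  set C : Set (EuclideanSpace ℝ (Fin 6)) :=
    {z | ∑ i : Fin 5, z (Fin.castSucc i) ^ 2 = 1 ∧ |z 5| ≤ B} with hC
  have hCcpt : IsCompact C := isCompact_cylinderSlab B
  have hrange : ∀ k, Set.range (ι k) ⊆ C := fun k => by
    rintro _ ⟨x, rfl⟩
    exact ⟨hN k x, hB k x⟩
  have hμC' : μ Cᶜ = 0 := hμC
  have haeC : ∀ᵐ z ∂μ, z ∈ C := mem_ae_iff.2 hμC'
  -- Step 2: the areas converge (test `g ≡ 1`), hence are eventually bounded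
  have hmass : Tendsto (fun k => (μH[4] : Measure (EuclideanSpace ℝ (Fin 6))).real (Set.range (ι k)))
      atTop (𝓝 (μ.real univ)) := by
    have h1 := hweak 1
    simpa only [BoundedContinuousFunction.coe_one, Pi.one_apply, setIntegral_const, integral_const,
      measureReal_restrict_apply_univ, smul_eq_mul, mul_one] using h1
  have hmassbd : ∀ᶠ k in atTop,
      (μH[4] : Measure (EuclideanSpace ℝ (Fin 6))).real (Set.range (ι k)) ≤ μ.real univ + 1 :=
    hmass.eventually_le_const (by linarith)
  -- Step 3: a bound `L ≥ 0` for `|K_{y₀,τ}|` on `C` and the clamped test function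
  obtain ⟨L₀, hL₀⟩ := hCcpt.exists_bound_of_continuousOn (continuous_cylKernel y₀ hτ).continuousOn
  set L : ℝ := max L₀ 0 with hL_def
  have hL0 : 0 ≤ L := le_max_right _ _
  have hL : ∀ z ∈ C, |cylKernel y₀ τ z| ≤ L := fun z hz =>
    (Real.norm_eq_abs _ ▸ hL₀ z hz).trans (le_max_left _ _)
  set Kc : EuclideanSpace ℝ (Fin 6) → ℝ := fun z => max (-L) (min L (cylKernel y₀ τ z)) with hKc
  have hKc_cont : Continuous Kc :=
    continuous_const.max (continuous_const.min (continuous_cylKernel y₀ hτ))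
  have hKc_bd : ∀ z, ‖Kc z‖ ≤ L := fun z => by
    rw [Real.norm_eq_abs, abs_le]
    exact ⟨le_max_left _ _, max_le (by linarith) (min_le_left _ _)⟩
  set g : BoundedContinuousFunction (EuclideanSpace ℝ (Fin 6)) ℝ :=
    BoundedContinuousFunction.ofNormedAddCommGroup Kc hKc_cont L hKc_bd with hg_def
  have hgC : ∀ z ∈ C, g z = cylKernel y₀ τ z := fun z hz => by
    have h := abs_le.1 (hL z hz)
    show max (-L) (min L (cylKernel y₀ τ z)) = cylKernel y₀ τ z
    rw [min_eq_right h.2, max_eq_right h.1]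
  -- Step 4: the weak convergence tested against `g` is the convergence for the FIXED centre `y₀`
  have hlim₀ : Tendsto (fun k => ∫ z in Set.range (ι k), cylKernel y₀ τ z
      ∂(μH[4] : Measure (EuclideanSpace ℝ (Fin 6)))) atTop (𝓝 (∫ z, cylKernel y₀ τ z ∂μ)) := by
    have h := hweak g
    have h2 : ∫ z, g z ∂μ = ∫ z, cylKernel y₀ τ z ∂μ := by
      refine integral_congr_ae ?_
      filter_upwards [haeC] with z hz using hgC z hz
    rw [h2] at h
    exact h.congr fun k => setIntegral_congr_fun (hmeas k) fun z hz => hgC z (hrange k hz)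
  -- Step 5: integrability of the kernels on the images
  have hKint : ∀ (p : EuclideanSpace ℝ (Fin 6)) (L' : ℝ), (∀ z ∈ C, |cylKernel p τ z| ≤ L') →
      ∀ k, IntegrableOn (fun z => cylKernel p τ z) (Set.range (ι k))
        (μH[4] : Measure (EuclideanSpace ℝ (Fin 6))) := fun p L' hp k =>
    Measure.integrableOn_of_bounded (hfin k).ne (continuous_cylKernel p hτ).aestronglyMeasurable
      (ae_restrict_of_forall_mem (hmeas k) fun z hz => by
        simpa only [Real.norm_eq_abs] using hp z (hrange k hz))
  -- Step 6: the moving-centre correction tends to zero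
  have hdiff : Tendsto (fun k => (∫ z in Set.range (ι k), cylKernel (y k) τ z
      ∂(μH[4] : Measure (EuclideanSpace ℝ (Fin 6)))) -
      ∫ z in Set.range (ι k), cylKernel y₀ τ z ∂(μH[4] : Measure (EuclideanSpace ℝ (Fin 6))))
      atTop (𝓝 0) := by
    rw [Metric.tendsto_nhds]
    intro ε hε
    have hm0 : 0 ≤ μ.real univ := measureReal_nonneg
    set ε' : ℝ := ε / (μ.real univ + 2) with hε'
    have hε'0 : 0 < ε' := div_pos hε (by linarith)
    filter_upwards [eventually_abs_cylKernel_sub_lt hCcpt hy hτ hε'0,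
      eventually_abs_cylKernel_sub_lt hCcpt hy hτ one_pos, hmassbd] with k hk hk1 hkm
    have hiy₀ : IntegrableOn (fun z => cylKernel y₀ τ z) (Set.range (ι k))
        (μH[4] : Measure (EuclideanSpace ℝ (Fin 6))) := hKint y₀ L hL k
    have hiyk : IntegrableOn (fun z => cylKernel (y k) τ z) (Set.range (ι k))
        (μH[4] : Measure (EuclideanSpace ℝ (Fin 6))) := by
      refine hKint (y k) (L + 1) (fun z hz => ?_) k
      have h1 := hk1 z hz
      have h2 := hL z hz
      calc |cylKernel (y k) τ z|
          = |(cylKernel (y k) τ z - cylKernel y₀ τ z) + cylKernel y₀ τ z| := by rw [sub_add_cancel]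
        _ ≤ |cylKernel (y k) τ z - cylKernel y₀ τ z| + |cylKernel y₀ τ z| := abs_add_le _ _
        _ ≤ L + 1 := by linarith
    rw [dist_zero_right, Real.norm_eq_abs, ← integral_sub hiyk hiy₀]
    have hbound := norm_setIntegral_le_of_norm_le_const (hfin k)
      (f := fun z => cylKernel (y k) τ z - cylKernel y₀ τ z) (C := ε')
      fun z hz => by rw [Real.norm_eq_abs]; exact (hk z (hrange k hz)).le
    rw [Real.norm_eq_abs] at hbound
    calc |∫ z in Set.range (ι k), (cylKernel (y k) τ z - cylKernel y₀ τ z)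
          ∂(μH[4] : Measure (EuclideanSpace ℝ (Fin 6)))|
        ≤ ε' * (μH[4] : Measure (EuclideanSpace ℝ (Fin 6))).real (Set.range (ι k)) := hbound
      _ ≤ ε' * (μ.real univ + 1) := mul_le_mul_of_nonneg_left hkm hε'0.le
      _ < ε := by
          rw [hε', div_mul_eq_mul_div, div_lt_iff₀ (by linarith)]
          exact mul_lt_mul_of_pos_left (by linarith) hε
  -- Step 7: assemble
  have h := hdiff.add hlim₀
  simp only [zero_add, sub_add_cancel] at h
  exact h

end Summit.SmoothPoincare4.SmoothPoincare4.Cruxes.CylinderRungTwo.KillingFlux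

end
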